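import Summits.Ventures.YMGap.RobustBall.HeatBathConcentrationDLR
import Summits.Ventures.YMGap.RobustBall.EnergyConcentrationDLR
import Summits.Ventures.YMGap.RobustBall.ConcentrationKR
import HarnessLib

/-!
# Robust ball (Y2) — SELF-AVERAGING OF THE TRANSLATES OF ANY LOCAL OBSERVABLE IN EVERY INFINITE-VOLUME GIBBS STATE, `L²` and exponential forms,
# on the Kantorovich–Rubinstein window

HONEST FRAMING: venture file of the cell `pub-ymgap` (QuantumFields programme), track ROBUST-BALL, seat rb-p2 (g14); the TRANSLATE-AVERAGE companion of
`EnergyConcentrationDLR.lean` (plaquette averages), from the heat-bath Poincaré inequality of every DLR state (g12, `HeatBathPoincareZdDLR`) and its concentration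
form (g14, `HeatBathConcentrationDLR`).  LATTICE statements at STRONG COUPLING for the DLR states `μ ∈ 𝒢(γ)` of the Wilson specification of `SU(N)` on `ℤ^d`
('t Hooft `β`, bare `Nβ`); Wilson action (class K); nothing about `β → ∞`, the continuum or Clay.
THE OBJECT.  A Lipschitz cylinder `F` on the links `Δ` with link oscillations `|F(U) − F(U[e ↦ s])| ≤ δ_e` (`δ ≥ 0`, `δ = 0` off `Δ`, `‖δ‖₁ := ∑_{e∈Δ} δ_e > 0`), and its
empirical average over a non-empty finite set `B ⊂ ℤ^d` of translations, `A_B = |B|⁻¹ ∑_{x∈B} F ∘ θ_x` (`θ_x = configShift x`).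
* `configShift_update` — `θ_x(U[y ↦ s]) = (θ_x U)[(y + x) ↦ s]`; `abs_translateAverage_sub_update_le` — the oscillation of `A_B` in the link `y` is
  `≤ D_y := |B|⁻¹ ∑_{x∈B} δ_{(y.1 + x, y.2)}`; `sum_osc_translateAverage_le` ∕ `osc_translateAverage_le` — `∑_y D_y ≤ ‖δ‖₁`, `D_y ≤ ‖δ‖₁/|B|`, hence
  `sum_sq_osc_translateAverage_le`: `∑_y D_y² ≤ ‖δ‖₁²/|B|`; `isLipschitzCylinder_translateAverage` — `A_B` is a Lipschitz cylinder on `⋃_x (Δ − x)`.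
* ★★★ `gibbs_variance_translateAverage_le_of_oneLinkKRModulus` — KR window `2(d−1)|β| ≤ R`, `OneLinkKRModulus N R K`, `6(d−1)|β|K ≤ c < 1`: for EVERY DLR state,
  `Var_μ(A_B) ≤ (2(1 − c))⁻¹ ‖δ‖₁² / |B|` — the `L²` ergodic theorem with rate `1/|B|` for every local Lipschitz observable, in infinite volume, no uniqueness;
* ★★★ `gibbs_translateAverage_deviation_le_of_oneLinkKRModulus` — for every `r ≥ 0`, `μ{|A_B − E_μ A_B| ≥ r} ≤ 2e^{2/3} exp(−r √((1 − c)|B|)/‖δ‖₁)`;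
* ★★★ `su2_gibbs_translateAverage_deviation_le` ∕ `su2_gibbs_variance_translateAverage_le` — `SU(2)`, `d = 4`, HYPOTHESIS-FREE on `0 ≤ β_W < 2/9`:
  `Var_μ(A_B) ≤ ‖δ‖₁²/((2 − 9β_W)|B|)` and `μ{|A_B − E_μ A_B| ≥ r} ≤ 2e^{2/3} exp(−r √((1 − 9β_W/2)|B|)/‖δ‖₁)`.
PRIOR ART IN THE TREE (say so when quoting): ds-3's GAUSSIAN column (`ConcentrationKR`/`ConcentrationBall`: Külske–McDiarmid, `2 exp(−2a²|B|/v)`, SU(2) d = 4 window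
`β_W < 1/6`, Wilson cell to `1/12`) — stronger tails on a smaller window; this file: the Poincaré route, exponential tails, KR window `β_W < 2/9`, explicit
`‖δ‖₁`; neither implies the other.  0 sorry, 0 definitions.  Everything here is proved. [folklore]
-/

noncomputable section

open MeasureTheory Function Real Finset ProbabilityTheory Filter Topology
open scoped NNReal
open Summit.QuantumFields.YangMills.Theorems.StrongPinningPoincare
open Literature.Probability.LatticeModels Literature.Probability.LatticeModels.DobrushinMetric
open Literature.MathematicalPhysics.QuantumLattice hiding torusNorm
open Literature.MathematicalPhysics.QuantumFieldTheory hiding ZdEdge Site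
open Literature.MathematicalPhysics.QuantumFieldTheory.Balaban1983to89.StrongCouplingDobrushinWindow (OneLinkKRModulus)

namespace Summit.Ventures.YMGap.RobustBall.HeatBathConcentration

variable {d N : ℕ}

/-! ### Translates, updates and oscillations -/

section Translates

variable {G : Type*} [Group G] [MeasurableSpace G]

omit [Group G] in
/-- `θ_x(U[y ↦ s]) = (θ_x U)[(y.1 + x, y.2) ↦ s]`. [folklore] -/
theorem configShift_update (x : Literature.Probability.LatticeModels.Site d) (U : LGConfig d G) (y : ZdEdge d) (s : G) :
    configShift x (update U y s) = update (configShift x U) (y.1 + x, y.2) s := by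
  classical
  funext e
  rw [Literature.MathematicalPhysics.QuantumLattice.configShift_apply]
  by_cases he : e = (y.1 + x, y.2)
  · subst he
    simp
  · rw [update_of_ne he, Literature.MathematicalPhysics.QuantumLattice.configShift_apply, update_of_ne]
    intro h
    apply he
    rw [Prod.ext_iff] at h ⊢
    refine ⟨?_, h.2⟩
    simp only at h ⊢
    rw [← h.1, sub_add_cancel]

end Translates

section Average

/-- **Link oscillation of a translate average**: if `|F(U) − F(U[e ↦ s])| ≤ δ_e` for all links `e`, then the average `A_B = |B|⁻¹ ∑_{x∈B} F ∘ θ_x` moves by at most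
`D_y = |B|⁻¹ ∑_{x∈B} δ_{(y.1 + x, y.2)}` when the link `y` is changed. [folklore] -/
theorem abs_translateAverage_sub_update_le {F : LGConfig d (Matrix.specialUnitaryGroup (Fin N) ℂ) → ℝ} {δ : ZdEdge d → ℝ}
    (hδ : ∀ e U s, |F U - F (update U e s)| ≤ δ e) (B : Finset (Literature.Probability.LatticeModels.Site d))
    (y : ZdEdge d) (U : LGConfig d (Matrix.specialUnitaryGroup (Fin N) ℂ)) (s : Matrix.specialUnitaryGroup (Fin N) ℂ) :
    |(B.card : ℝ)⁻¹ * ∑ x ∈ B, F (configShift x U) - (B.card : ℝ)⁻¹ * ∑ x ∈ B, F (configShift x (update U y s))| ≤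
      (B.card : ℝ)⁻¹ * ∑ x ∈ B, δ (y.1 + x, y.2) := by
  rw [← mul_sub, ← Finset.sum_sub_distrib, abs_mul, abs_inv, abs_of_nonneg (Nat.cast_nonneg _)]
  refine mul_le_mul_of_nonneg_left ((Finset.abs_sum_le_sum_abs _ _).trans (Finset.sum_le_sum fun x _ => ?_)) (by positivity)
  rw [configShift_update]
  exact hδ _ _ _

/-- For fixed `y`, `∑_{x∈B} δ_{(y.1 + x, y.2)} ≤ ‖δ‖₁ = ∑_{e∈Δ} δ_e` (`δ ≥ 0`, `δ = 0` off `Δ`; `x ↦ (y.1 + x, y.2)` is injective). [folklore] -/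
theorem sum_translates_delta_le {δ : ZdEdge d → ℝ} (hδ0 : ∀ e, 0 ≤ δ e) {Δ : Finset (ZdEdge d)} (hδΔ : ∀ e, e ∉ Δ → δ e = 0)
    (B : Finset (Literature.Probability.LatticeModels.Site d)) (y : ZdEdge d) :
    ∑ x ∈ B, δ (y.1 + x, y.2) ≤ ∑ e ∈ Δ, δ e := by
  classical
  have hinj : Set.InjOn (fun x : Literature.Probability.LatticeModels.Site d => ((y.1 + x, y.2) : ZdEdge d)) ↑B := by
    intro a _ b _ h
    have := congrArg Prod.fst h
    simpa using this
  rw [← Finset.sum_image (f := δ) hinj]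
  set I := B.image fun x : Literature.Probability.LatticeModels.Site d => ((y.1 + x, y.2) : ZdEdge d) with hI
  calc ∑ e ∈ I, δ e ≤ ∑ e ∈ I ∪ Δ, δ e := Finset.sum_le_sum_of_subset_of_nonneg Finset.subset_union_left fun e _ _ => hδ0 e
    _ = ∑ e ∈ Δ, δ e := by
        refine (Finset.sum_subset Finset.subset_union_right fun e he hne => hδΔ e hne).symm

/-- For fixed `x`, `∑_{y∈S} δ_{(y.1 + x, y.2)} ≤ ‖δ‖₁` for ANY finite link set `S` (`y ↦ (y.1 + x, y.2)` is injective). [folklore] -/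
theorem sum_links_delta_translate_le {δ : ZdEdge d → ℝ} (hδ0 : ∀ e, 0 ≤ δ e) {Δ : Finset (ZdEdge d)} (hδΔ : ∀ e, e ∉ Δ → δ e = 0)
    (S : Finset (ZdEdge d)) (x : Literature.Probability.LatticeModels.Site d) :
    ∑ y ∈ S, δ (y.1 + x, y.2) ≤ ∑ e ∈ Δ, δ e := by
  classical
  have hinj : Set.InjOn (fun y : ZdEdge d => ((y.1 + x, y.2) : ZdEdge d)) ↑S := by
    intro a _ b _ h
    rw [Prod.ext_iff] at h ⊢
    exact ⟨by simpa using h.1, h.2⟩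
  rw [← Finset.sum_image (f := δ) hinj]
  set I := S.image fun y : ZdEdge d => ((y.1 + x, y.2) : ZdEdge d) with hI
  calc ∑ e ∈ I, δ e ≤ ∑ e ∈ I ∪ Δ, δ e := Finset.sum_le_sum_of_subset_of_nonneg Finset.subset_union_left fun e _ _ => hδ0 e
    _ = ∑ e ∈ Δ, δ e := (Finset.sum_subset Finset.subset_union_right fun e he hne => hδΔ e hne).symm

/-- **`∑_y D_y² ≤ ‖δ‖₁²/|B|`** over any finite set of links `S`, for `D_y = |B|⁻¹ ∑_{x∈B} δ_{(y.1 + x, y.2)}` (`D_y ≤ ‖δ‖₁/|B|` and `∑_y D_y ≤ ‖δ‖₁`). [folklore] -/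
theorem sum_sq_osc_translateAverage_le {δ : ZdEdge d → ℝ} (hδ0 : ∀ e, 0 ≤ δ e) {Δ : Finset (ZdEdge d)} (hδΔ : ∀ e, e ∉ Δ → δ e = 0)
    {B : Finset (Literature.Probability.LatticeModels.Site d)} (hB : B.Nonempty) (S : Finset (ZdEdge d)) :
    ∑ y ∈ S, ((B.card : ℝ)⁻¹ * ∑ x ∈ B, δ (y.1 + x, y.2)) ^ 2 ≤ (∑ e ∈ Δ, δ e) ^ 2 / B.card := by
  set L : ℝ := ∑ e ∈ Δ, δ e with hL
  have hBpos : (0 : ℝ) < B.card := by exact_mod_cast hB.card_pos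
  have hDnn : ∀ y : ZdEdge d, 0 ≤ (B.card : ℝ)⁻¹ * ∑ x ∈ B, δ (y.1 + x, y.2) := fun y => mul_nonneg (by positivity) (Finset.sum_nonneg fun x _ => hδ0 _)
  have hDle : ∀ y : ZdEdge d, (B.card : ℝ)⁻¹ * ∑ x ∈ B, δ (y.1 + x, y.2) ≤ (B.card : ℝ)⁻¹ * L := fun y =>
    mul_le_mul_of_nonneg_left (sum_translates_delta_le hδ0 hδΔ B y) (by positivity)
  -- `∑_y D_y ≤ L`
  have hsumD : ∑ y ∈ S, (B.card : ℝ)⁻¹ * ∑ x ∈ B, δ (y.1 + x, y.2) ≤ L := by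
    rw [← Finset.mul_sum, Finset.sum_comm]
    calc (B.card : ℝ)⁻¹ * ∑ x ∈ B, ∑ y ∈ S, δ (y.1 + x, y.2) ≤ (B.card : ℝ)⁻¹ * ∑ _x ∈ B, L :=
          mul_le_mul_of_nonneg_left (Finset.sum_le_sum fun x _ => sum_links_delta_translate_le hδ0 hδΔ S x) (by positivity)
      _ = L := by rw [Finset.sum_const, nsmul_eq_mul, ← mul_assoc, inv_mul_cancel₀ hBpos.ne', one_mul]
  calc ∑ y ∈ S, ((B.card : ℝ)⁻¹ * ∑ x ∈ B, δ (y.1 + x, y.2)) ^ 2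
      ≤ ∑ y ∈ S, ((B.card : ℝ)⁻¹ * L) * ((B.card : ℝ)⁻¹ * ∑ x ∈ B, δ (y.1 + x, y.2)) :=
        Finset.sum_le_sum fun y _ => by rw [sq]; exact mul_le_mul_of_nonneg_right (hDle y) (hDnn y)
    _ = ((B.card : ℝ)⁻¹ * L) * ∑ y ∈ S, (B.card : ℝ)⁻¹ * ∑ x ∈ B, δ (y.1 + x, y.2) := by rw [← Finset.mul_sum]
    _ ≤ ((B.card : ℝ)⁻¹ * L) * L := mul_le_mul_of_nonneg_left hsumD (mul_nonneg (by positivity) (Finset.sum_nonneg fun e _ => hδ0 e))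
    _ = L ^ 2 / B.card := by rw [sq]; field_simp

/-- **The translate average is a Lipschitz cylinder** on the union of the translated supports, with the same constant. [folklore] -/
theorem isLipschitzCylinder_translateAverage {F : LGConfig d (Matrix.specialUnitaryGroup (Fin N) ℂ) → ℝ} {Δ : Finset (ZdEdge d)} {KF : ℝ≥0}
    (hF : IsLipschitzCylinder (fundamentalRep (Fin N)) F Δ KF) (B : Finset (Literature.Probability.LatticeModels.Site d)) :
    IsLipschitzCylinder (fundamentalRep (Fin N)) (fun U => (B.card : ℝ)⁻¹ * ∑ x ∈ B, F (configShift x U))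
      (B.biUnion fun x => Δ.image fun e => (e.1 - x, e.2)) KF := by
  classical
  set S := B.biUnion fun x => Δ.image fun e : ZdEdge d => ((e.1 - x, e.2) : ZdEdge d) with hS
  refine ZdSmoothing.isLipschitzCylinder_of_dist_le fun U V => ?_
  set dSUV := dist (fun e : ↥S => suEntries (U e)) (fun e : ↥S => suEntries (V e)) with hd
  have hterm : ∀ x ∈ B, |F (configShift x U) - F (configShift x V)| ≤ KF * dSUV := by
    intro x hx
    obtain ⟨f, hf, hFf⟩ := (isLipschitzCylinder_comp_configShift hF x).exists_suEntries
    have e1 : F (configShift x U) = (F ∘ configShift x) U := rfl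
    have e2 : F (configShift x V) = (F ∘ configShift x) V := rfl
    rw [e1, e2, hFf, hFf, ← Real.dist_eq]
    refine (hf.dist_le_mul _ _).trans (mul_le_mul_of_nonneg_left ?_ KF.2)
    exact CouplingResponse.dist_restrict_le (Finset.subset_biUnion_of_mem (fun x => Δ.image fun e : ZdEdge d => ((e.1 - x, e.2) : ZdEdge d)) hx) U V
  by_cases hB : B.card = 0
  · rw [Finset.card_eq_zero.1 hB]; simp; positivity
  have hBpos : (0 : ℝ) < B.card := by exact_mod_cast Nat.pos_of_ne_zero hB
  rw [← mul_sub, ← Finset.sum_sub_distrib, abs_mul, abs_inv, abs_of_pos hBpos]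
  calc (B.card : ℝ)⁻¹ * |∑ x ∈ B, (F (configShift x U) - F (configShift x V))|
      ≤ (B.card : ℝ)⁻¹ * ∑ x ∈ B, (KF : ℝ) * dSUV :=
        mul_le_mul_of_nonneg_left ((Finset.abs_sum_le_sum_abs _ _).trans (Finset.sum_le_sum hterm)) (by positivity)
    _ = KF * dSUV := by rw [Finset.sum_const, nsmul_eq_mul, ← mul_assoc, inv_mul_cancel₀ hBpos.ne', one_mul]

end Average

/-! ### Self-averaging in every Gibbs state -/

section Gibbs

/-- ★★★ **`L²` ERGODIC THEOREM WITH RATE IN EVERY INFINITE-VOLUME GIBBS STATE** (`SU(N)` on `ℤ^d`, 't Hooft `β`, bare `Nβ`; KR window `2(d−1)|β| ≤ R`,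
`OneLinkKRModulus N R K`, `6(d−1)|β|K ≤ c < 1`): for every DLR state `μ`, every Lipschitz cylinder `F` on `Δ` with link oscillations `δ ≥ 0` (`δ = 0` off `Δ`) and every
non-empty finite set `B` of translations, `Var_μ(|B|⁻¹ ∑_{x∈B} F ∘ θ_x) ≤ (2(1 − c))⁻¹ ‖δ‖₁² / |B|`. [folklore] -/
theorem gibbs_variance_translateAverage_le_of_oneLinkKRModulus (hd : 1 ≤ d) (hN : 1 ≤ N) {β R K c : ℝ} (hK : 0 ≤ K)
    (hR : |β| * (2 * ((d : ℝ) - 1)) ≤ R) (hmod : OneLinkKRModulus N R K) (hc : 6 * ((d : ℝ) - 1) * |β| * K ≤ c) (hc1 : c < 1)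
    {μ : Measure (LGConfig d (Matrix.specialUnitaryGroup (Fin N) ℂ))}
    (hμ : μ ∈ ymGibbsMeasures (d := d) (fundamentalRep (Fin N)) (N * β))
    {F : LGConfig d (Matrix.specialUnitaryGroup (Fin N) ℂ) → ℝ} {Δ : Finset (ZdEdge d)} {KF : ℝ≥0}
    (hF : IsLipschitzCylinder (fundamentalRep (Fin N)) F Δ KF) {δ : ZdEdge d → ℝ} (hδ0 : ∀ e, 0 ≤ δ e) (hδΔ : ∀ e, e ∉ Δ → δ e = 0)
    (hδ : ∀ e U s, |F U - F (update U e s)| ≤ δ e) {B : Finset (Literature.Probability.LatticeModels.Site d)} (hB : B.Nonempty) :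
    ProbabilityTheory.variance (fun U => (B.card : ℝ)⁻¹ * ∑ x ∈ B, F (configShift x U)) μ ≤ (2 * (1 - c))⁻¹ * ((∑ e ∈ Δ, δ e) ^ 2 / B.card) := by
  classical
  have hc0 : 0 < 2 * (1 - c) := by linarith
  have h := HeatBathPoincareZd.gibbsVariance_le_sum_osc_sq hd hN hK hR hmod hc hc1 hμ (isLipschitzCylinder_translateAverage hF B)
    (fun y : ZdEdge d => (B.card : ℝ)⁻¹ * ∑ x ∈ B, δ (y.1 + x, y.2)) (fun y U s => abs_translateAverage_sub_update_le hδ B y U s)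
  exact h.trans (mul_le_mul_of_nonneg_left (sum_sq_osc_translateAverage_le hδ0 hδΔ hB _) (inv_nonneg.2 hc0.le))

/-- ★★★ **EXPONENTIAL SELF-AVERAGING OF TRANSLATE AVERAGES IN EVERY GIBBS STATE**: under the hypotheses of
`gibbs_variance_translateAverage_le_of_oneLinkKRModulus` with `‖δ‖₁ > 0`, for every `r ≥ 0`,
`μ{|A_B − E_μ A_B| ≥ r} ≤ 2e^{2/3} exp(−r √((1 − c)|B|)/‖δ‖₁)`. [folklore] -/
theorem gibbs_translateAverage_deviation_le_of_oneLinkKRModulus (hd : 1 ≤ d) (hN : 1 ≤ N) {β R K c : ℝ} (hK : 0 ≤ K)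
    (hR : |β| * (2 * ((d : ℝ) - 1)) ≤ R) (hmod : OneLinkKRModulus N R K) (hc : 6 * ((d : ℝ) - 1) * |β| * K ≤ c) (hc1 : c < 1)
    {μ : Measure (LGConfig d (Matrix.specialUnitaryGroup (Fin N) ℂ))}
    (hμ : μ ∈ ymGibbsMeasures (d := d) (fundamentalRep (Fin N)) (N * β))
    {F : LGConfig d (Matrix.specialUnitaryGroup (Fin N) ℂ) → ℝ} {Δ : Finset (ZdEdge d)} {KF : ℝ≥0}
    (hF : IsLipschitzCylinder (fundamentalRep (Fin N)) F Δ KF) {δ : ZdEdge d → ℝ} (hδ0 : ∀ e, 0 ≤ δ e) (hδΔ : ∀ e, e ∉ Δ → δ e = 0)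
    (hδ : ∀ e U s, |F U - F (update U e s)| ≤ δ e) (hL : 0 < ∑ e ∈ Δ, δ e)
    {B : Finset (Literature.Probability.LatticeModels.Site d)} (hB : B.Nonempty) {r : ℝ} (hr : 0 ≤ r) :
    μ.real {U | r ≤ |(B.card : ℝ)⁻¹ * ∑ x ∈ B, F (configShift x U) - ∫ U', (B.card : ℝ)⁻¹ * ∑ x ∈ B, F (configShift x U') ∂μ|} ≤
      2 * (Real.exp (2 / 3) * Real.exp (-(r * Real.sqrt (((∑ e ∈ Δ, δ e) ^ 2 / ((1 - c) * B.card))⁻¹)))) := by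
  classical
  haveI : SecondCountableTopology (Matrix (Fin N) (Fin N) ℂ) := inferInstanceAs (SecondCountableTopology (Fin N → Fin N → ℂ))
  haveI : SecondCountableTopology (Matrix.specialUnitaryGroup (Fin N) ℂ) := Topology.IsEmbedding.subtypeVal.secondCountableTopology
  have hμ' : IsGibbsMeasure (ymSpecification (d := d) (fundamentalRep (Fin N)) (N * β)) μ := hμ
  haveI := hμ'.isProbabilityMeasure
  have hc0 : 0 < 1 - c := by linarith
  have hBpos : (0 : ℝ) < B.card := by exact_mod_cast hB.card_pos
  set S := B.biUnion fun x => Δ.image fun e : ZdEdge d => ((e.1 - x, e.2) : ZdEdge d) with hS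
  have hFav := isLipschitzCylinder_translateAverage hF B
  have hosc : ∀ y ∈ S, ∀ (U : LGConfig d (Matrix.specialUnitaryGroup (Fin N) ℂ)) (s : Matrix.specialUnitaryGroup (Fin N) ℂ),
      |(B.card : ℝ)⁻¹ * ∑ x ∈ B, F (configShift x U) - (B.card : ℝ)⁻¹ * ∑ x ∈ B, F (configShift x (update U y s))| ≤
        (B.card : ℝ)⁻¹ * ∑ x ∈ B, δ (y.1 + x, y.2) := fun y _ U s => abs_translateAverage_sub_update_le hδ B y U s
  -- positivity of the oscillation square-sum: pick `e ∈ Δ` with `δ_e > 0` and `x ∈ B`; then `y = (e.1 − x, e.2) ∈ S` has `D_y ≥ δ_e/|B| > 0`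
  have hD : 0 < ∑ y ∈ S, ((B.card : ℝ)⁻¹ * ∑ x ∈ B, δ (y.1 + x, y.2)) ^ 2 := by
    obtain ⟨e, heΔ, he⟩ : ∃ e ∈ Δ, 0 < δ e := by
      by_contra hne
      push Not at hne
      exact (lt_irrefl _) (hL.trans_le (Finset.sum_nonpos fun e he' => hne e he'))
    obtain ⟨x, hx⟩ := hB
    set y : ZdEdge d := (e.1 - x, e.2) with hy
    have hyS : y ∈ S := Finset.mem_biUnion.2 ⟨x, hx, Finset.mem_image.2 ⟨e, heΔ, rfl⟩⟩
    refine lt_of_lt_of_le ?_ (Finset.single_le_sum (fun y _ => sq_nonneg _) hyS)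
    have h1 : δ e ≤ ∑ x' ∈ B, δ (y.1 + x', y.2) := by
      have : δ (y.1 + x, y.2) = δ e := by rw [hy]; simp
      rw [← this]
      exact Finset.single_le_sum (f := fun x' => δ (y.1 + x', y.2)) (fun x' _ => hδ0 _) hx
    have h2 : 0 < (B.card : ℝ)⁻¹ * ∑ x' ∈ B, δ (y.1 + x', y.2) := mul_pos (by positivity) (he.trans_le h1)
    positivity
  have hup := gibbs_measureReal_deviation_ge_le_of_oneLinkKRModulus hd hN hK hR hmod hc hc1 hμ hFav _ hosc hD r
  have hdown := gibbs_measureReal_deviation_le_le_of_oneLinkKRModulus hd hN hK hR hmod hc hc1 hμ hFav _ hosc hD r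
  have hκpos : 0 < 2 * (2 * (1 - c))⁻¹ * ∑ y ∈ S, ((B.card : ℝ)⁻¹ * ∑ x ∈ B, δ (y.1 + x, y.2)) ^ 2 := by positivity
  have hκle : 2 * (2 * (1 - c))⁻¹ * ∑ y ∈ S, ((B.card : ℝ)⁻¹ * ∑ x ∈ B, δ (y.1 + x, y.2)) ^ 2 ≤ (∑ e ∈ Δ, δ e) ^ 2 / ((1 - c) * B.card) := by
    have h1 := sum_sq_osc_translateAverage_le hδ0 hδΔ hB S
    calc _ = (1 - c)⁻¹ * ∑ y ∈ S, ((B.card : ℝ)⁻¹ * ∑ x ∈ B, δ (y.1 + x, y.2)) ^ 2 := by field_simp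
      _ ≤ (1 - c)⁻¹ * ((∑ e ∈ Δ, δ e) ^ 2 / B.card) := mul_le_mul_of_nonneg_left h1 (inv_nonneg.2 hc0.le)
      _ = (∑ e ∈ Δ, δ e) ^ 2 / ((1 - c) * B.card) := by field_simp
  have hrate := exp_neg_div_sqrt_le hκpos hκle hr
  refine measureReal_abs_ge_le_of_tails μ (hup.trans ?_) (hdown.trans ?_) <;>
    exact mul_le_mul_of_nonneg_left hrate (Real.exp_pos _).le

/-- ★★★ **`SU(2)`, `d = 4`, HYPOTHESIS-FREE on `0 ≤ β_W < 2/9`** (tree coupling `β_W/2`): for EVERY DLR state of 4D `SU(2)` lattice Yang–Mills, every Lipschitz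
cylinder `F` with link oscillations `δ` (`‖δ‖₁ > 0`), every non-empty finite `B ⊂ ℤ⁴` and `r ≥ 0`,
`μ{|A_B − E_μ A_B| ≥ r} ≤ 2e^{2/3} exp(−r √((1 − 9β_W/2)|B|)/‖δ‖₁)`. [folklore] -/
theorem su2_gibbs_translateAverage_deviation_le {βW : ℝ} (h0 : 0 ≤ βW) (h : βW < 2 / 9)
    {μ : Measure (LGConfig 4 (Matrix.specialUnitaryGroup (Fin 2) ℂ))}
    (hμ : μ ∈ ymGibbsMeasures (d := 4) (fundamentalRep (Fin 2)) (βW / 2))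
    {F : LGConfig 4 (Matrix.specialUnitaryGroup (Fin 2) ℂ) → ℝ} {Δ : Finset (ZdEdge 4)} {KF : ℝ≥0}
    (hF : IsLipschitzCylinder (fundamentalRep (Fin 2)) F Δ KF) {δ : ZdEdge 4 → ℝ} (hδ0 : ∀ e, 0 ≤ δ e) (hδΔ : ∀ e, e ∉ Δ → δ e = 0)
    (hδ : ∀ e U s, |F U - F (update U e s)| ≤ δ e) (hL : 0 < ∑ e ∈ Δ, δ e)
    {B : Finset (Literature.Probability.LatticeModels.Site 4)} (hB : B.Nonempty) {r : ℝ} (hr : 0 ≤ r) :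
    μ.real {U | r ≤ |(B.card : ℝ)⁻¹ * ∑ x ∈ B, F (configShift x U) - ∫ U', (B.card : ℝ)⁻¹ * ∑ x ∈ B, F (configShift x U') ∂μ|} ≤
      2 * (Real.exp (2 / 3) * Real.exp (-(r * Real.sqrt ((1 - 9 * βW / 2) * B.card / (∑ e ∈ Δ, δ e) ^ 2)))) := by
  have hβ : ((2 : ℕ) : ℝ) * (βW / 4) = βW / 2 := by push_cast; ring
  have habs : |βW / 4| = βW / 4 := abs_of_nonneg (by positivity)
  have hμ4 : μ ∈ ymGibbsMeasures (d := 4) (fundamentalRep (Fin 2)) ((2 : ℕ) * (βW / 4)) := by rwa [hβ]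
  have key := gibbs_translateAverage_deviation_le_of_oneLinkKRModulus (d := 4) (N := 2) (by norm_num) (by norm_num) (β := βW / 4) (R := 3 * βW / 2)
    zero_le_one (by rw [habs]; norm_num; linarith) (SlabAreaLawDimensions.su2_oneLinkKRModulus_of_le_one (by linarith)) (c := 9 * βW / 2)
    (by rw [habs]; norm_num; linarith) (by linarith) hμ4 hF hδ0 hδΔ hδ hL hB hr
  have e : ((∑ e ∈ Δ, δ e) ^ 2 / ((1 - 9 * βW / 2) * (B.card : ℝ)))⁻¹ = (1 - 9 * βW / 2) * B.card / (∑ e ∈ Δ, δ e) ^ 2 := by rw [inv_div]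
  rw [e] at key
  exact key

/-- ★★ **`SU(2)`, `d = 4`, `0 ≤ β_W < 2/9`, `L²` form**: `Var_μ(A_B) ≤ ‖δ‖₁²/((2 − 9β_W)|B|)` for every DLR state. [folklore] -/
theorem su2_gibbs_variance_translateAverage_le {βW : ℝ} (h0 : 0 ≤ βW) (h : βW < 2 / 9)
    {μ : Measure (LGConfig 4 (Matrix.specialUnitaryGroup (Fin 2) ℂ))}
    (hμ : μ ∈ ymGibbsMeasures (d := 4) (fundamentalRep (Fin 2)) (βW / 2))
    {F : LGConfig 4 (Matrix.specialUnitaryGroup (Fin 2) ℂ) → ℝ} {Δ : Finset (ZdEdge 4)} {KF : ℝ≥0}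
    (hF : IsLipschitzCylinder (fundamentalRep (Fin 2)) F Δ KF) {δ : ZdEdge 4 → ℝ} (hδ0 : ∀ e, 0 ≤ δ e) (hδΔ : ∀ e, e ∉ Δ → δ e = 0)
    (hδ : ∀ e U s, |F U - F (update U e s)| ≤ δ e) {B : Finset (Literature.Probability.LatticeModels.Site 4)} (hB : B.Nonempty) :
    ProbabilityTheory.variance (fun U => (B.card : ℝ)⁻¹ * ∑ x ∈ B, F (configShift x U)) μ ≤ (∑ e ∈ Δ, δ e) ^ 2 / ((2 - 9 * βW) * B.card) := by
  have hβ : ((2 : ℕ) : ℝ) * (βW / 4) = βW / 2 := by push_cast; ring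
  have habs : |βW / 4| = βW / 4 := abs_of_nonneg (by positivity)
  have hμ4 : μ ∈ ymGibbsMeasures (d := 4) (fundamentalRep (Fin 2)) ((2 : ℕ) * (βW / 4)) := by rwa [hβ]
  have key := gibbs_variance_translateAverage_le_of_oneLinkKRModulus (d := 4) (N := 2) (by norm_num) (by norm_num) (β := βW / 4) (R := 3 * βW / 2)
    zero_le_one (by rw [habs]; norm_num; linarith) (SlabAreaLawDimensions.su2_oneLinkKRModulus_of_le_one (by linarith)) (c := 9 * βW / 2)
    (by rw [habs]; norm_num; linarith) (by linarith) hμ4 hF hδ0 hδΔ hδ hB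
  have hBpos : (0 : ℝ) < B.card := by exact_mod_cast hB.card_pos
  have hc0 : 0 < 2 - 9 * βW := by linarith
  have e : (2 * (1 - 9 * βW / 2))⁻¹ * ((∑ e ∈ Δ, δ e) ^ 2 / (B.card : ℝ)) = (∑ e ∈ Δ, δ e) ^ 2 / ((2 - 9 * βW) * B.card) := by
    field_simp
  rw [e] at key
  exact key

end Gibbs

end Summit.Ventures.YMGap.RobustBall.HeatBathConcentration

end
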